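import Mathlib.Topology.Instances.AddCircle.DenseSubgroup
import Mathlib.Analysis.SpecialFunctions.Complex.Circle
import Mathlib.RingTheory.IntegralClosure.IntegrallyClosed
import Mathlib.Algebra.GCDMonoid.IntegrallyClosed
import Mathlib.RingTheory.IntegralClosure.IsIntegral.Basic
import Mathlib.Analysis.Complex.Basic
import HarnessLib

/-!
# Boykin et al. 1999, §3: the irrational rotation — circle subgroups and the algebraic-integer test

Topic `Literature/Computability/QuantumComplexity`, grouping namespace `BoykinEtAl` (the paper).
Two ingredients of the first step of the universality proof of Boykin–Mor–Pulver–Roychowdhury–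
Vatan (FOCS 1999, §3): the rotation `σ_z^{-1/4} σ_x^{1/4}` has eigenvalues `e^{±iλπ}` with
`cos λπ = cos²(π/8)`, and

* `λ` is irrational, i.e. `e^{iλπ}` is **not a root of unity** — `pow_ne_one_of_add_conj`: a unit
  complex number `z` with `z + z̄ = 2cos λπ = 1 + √2/2` has `zⁿ ≠ 1` for all `n ≥ 1`. The paper
  (App., Thm. 7.1) argues with the minimal polynomial `x⁴ + x³ + x²/4 + x + 1 ∉ ℤ[x]` of
  `e^{2πiλ}`; we use the equivalent algebraic-integer test directly: a root of unity is an
  algebraic integer, so `z + z̄ - 1 = √2/2` and its square `1/2` would be algebraic integers,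
  contradicting `IsIntegrallyClosed ℤ` (`not_isIntegral_inv_two`);
* hence its powers are dense in the one-parameter group it lies on — in the form used by the
  assembly: **a closed subgroup of the circle group containing an element of infinite order is
  the whole circle** (`circleSubgroup_eq_top_of_isClosed`, from Mathlib's
  `AddCircle.denseRange_zsmul_iff`, the irrational rotation of `ℝ/ℤ`, transported along
  `AddCircle.homeomorphCircle`). This is the paper's "since `λ` is irrational, it can be used
  to approximate any phase factor `e^{iφ}`: `e^{inλπ} ≈ e^{iφ}`" (eqs. (dense1)–(dense2)).

## References

* P. O. Boykin, T. Mor, M. Pulver, V. Roychowdhury, F. Vatan, *On universal and fault-tolerant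
  quantum computing*, FOCS 1999, 486–494, arXiv:quant-ph/9906054, §3 (eqs. (lambda),
  (dense1)–(dense2)) and App., Thm. 7.1 (cyclotomic/rational number theorem) [BoykinEtAl1999].

## Design notes

* No angles: "λ irrational" is replaced by the equivalent "`e^{iλπ}` has infinite order", and
  density of `{nλπ mod 2π}` by density of the cyclic subgroup in `Circle`.
-/

noncomputable section

namespace Literature.Computability.QuantumComplexity.BoykinEtAl

open Complex

/-! ### Closed subgroups of the circle -/

/-- **A closed subgroup of the circle containing an element of infinite order is everything**
(the cyclic group of an irrational rotation is dense: Mathlib `AddCircle.denseRange_zsmul_iff`,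
transported to `Circle` by `AddCircle.homeomorphCircle`; Boykin et al. 1999, §3,
eqs. (dense1)–(dense2)). [cite: BoykinEtAl1999, §3 eqs. (dense1)-(dense2)] -/
theorem circleSubgroup_eq_top_of_isClosed (H : Subgroup Circle) (hH : IsClosed (H : Set Circle))
    {z : Circle} (hz : z ∈ H) (hinf : ¬ IsOfFinOrder z) : H = ⊤ := by
  haveI : Fact ((0 : ℝ) < 1) := ⟨one_pos⟩
  set e := AddCircle.homeomorphCircle (one_ne_zero : (1 : ℝ) ≠ 0) with he_def
  have he : ∀ x, e x = AddCircle.toCircle x := AddCircle.homeomorphCircle_apply one_ne_zero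
  obtain ⟨a, ha⟩ := e.surjective z
  -- `a` has infinite additive order
  have ha0 : addOrderOf a = 0 := by
    rw [addOrderOf_eq_zero_iff]
    intro hfin
    apply hinf
    obtain ⟨n, hn, hna⟩ := hfin.exists_nsmul_eq_zero
    refine isOfFinOrder_iff_pow_eq_one.2 ⟨n, hn, ?_⟩
    rw [← ha, he, ← AddCircle.toCircle_nsmul, hna, AddCircle.toCircle_zero]
  have hdense : DenseRange (fun k : ℤ => k • a) := AddCircle.denseRange_zsmul_iff.2 ha0
  -- the closed set `e ⁻¹' H` contains the dense set of multiples of `a`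
  have hsub : Set.range (fun k : ℤ => k • a) ⊆ e ⁻¹' (H : Set Circle) := by
    rintro _ ⟨k, rfl⟩
    change e (k • a) ∈ (H : Set Circle)
    rw [he, AddCircle.toCircle_zsmul, ← he, ha]
    exact H.zpow_mem hz k
  have hclosed : IsClosed (e ⁻¹' (H : Set Circle)) := hH.preimage e.continuous
  have huniv : e ⁻¹' (H : Set Circle) = Set.univ := by
    apply Set.eq_univ_of_univ_subset
    rw [← hdense.closure_range]
    exact hclosed.closure_subset_iff.2 hsub
  rw [eq_top_iff]
  intro u _
  have hu : e.symm u ∈ e ⁻¹' (H : Set Circle) := by rw [huniv]; exact Set.mem_univ _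
  simpa using hu

/-! ### The algebraic-integer test -/

/-- `1/2` is not an algebraic integer (`ℤ` is integrally closed). [folklore] -/
theorem not_isIntegral_inv_two : ¬ IsIntegral ℤ ((2 : ℂ)⁻¹) := by
  intro h
  have h' : IsIntegral ℤ ((2 : ℚ)⁻¹) := by
    have hinj : Function.Injective (algebraMap ℚ ℂ) := (algebraMap ℚ ℂ).injective
    rw [← isIntegral_algebraMap_iff hinj, map_inv₀, map_ofNat]
    exact h
  obtain ⟨m, hm⟩ := IsIntegrallyClosed.algebraMap_eq_of_integral h'
  have hm' : (2 : ℚ) * (m : ℚ) = 1 := by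
    rw [show ((m : ℚ)) = algebraMap ℤ ℚ m from rfl, hm]
    norm_num
  have h2 : (2 * m : ℤ) = 1 := by exact_mod_cast hm'
  omega

/-- **`e^{iλπ}` is not a root of unity** (Boykin et al. 1999, §3 with App. Thm. 7.1: `λ ∉ ℚ`
where `cos λπ = cos²(π/8) = (1 + 1/√2)/2`). In the form: a complex number `z` with
`z + z̄ = 1 + √2/2` (`= 2cos²(π/8)`) satisfies `zⁿ ≠ 1` for every `n ≥ 1`. Proof: if `zⁿ = 1`
then `z` and `z̄` are algebraic integers, hence so are `z + z̄ - 1 = √2/2` and its square `1/2`,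
which is absurd. [cite: BoykinEtAl1999, §3 eq. (lambda) and App. Thm. 7.1] -/
theorem pow_ne_one_of_add_conj {z : ℂ} (hz : z + starRingEnd ℂ z = 1 + (Real.sqrt 2 : ℂ) / 2)
    {n : ℕ} (hn : 0 < n) : z ^ n ≠ 1 := by
  intro h
  have hi : IsIntegral ℤ z := IsIntegral.of_pow hn (by rw [h]; exact isIntegral_one)
  have hic : IsIntegral ℤ (starRingEnd ℂ z) :=
    IsIntegral.of_pow hn (by rw [← map_pow, h, map_one]; exact isIntegral_one)
  have hs : IsIntegral ℤ ((Real.sqrt 2 : ℂ) / 2) := by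
    have h3 := (hi.add hic).sub isIntegral_one
    rw [hz, add_sub_cancel_left] at h3
    exact h3
  have hsq : (Real.sqrt 2 : ℂ) / 2 * ((Real.sqrt 2 : ℂ) / 2) = (2 : ℂ)⁻¹ := by
    rw [div_mul_div_comm, ← Complex.ofReal_mul, Real.mul_self_sqrt zero_le_two]
    push_cast
    norm_num
  exact not_isIntegral_inv_two (hsq ▸ hs.mul hs)

/-- The same for a point of the circle group: if `z + z̄ = 1 + √2/2` then `z ∈ Circle` has
infinite order. [cite: BoykinEtAl1999, §3 eq. (lambda) and App. Thm. 7.1] -/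
theorem not_isOfFinOrder_of_add_conj {z : Circle}
    (hz : (z : ℂ) + starRingEnd ℂ (z : ℂ) = 1 + (Real.sqrt 2 : ℂ) / 2) : ¬ IsOfFinOrder z := by
  intro hfin
  obtain ⟨n, hn, hzn⟩ := isOfFinOrder_iff_pow_eq_one.1 hfin
  refine pow_ne_one_of_add_conj hz hn ?_
  rw [← Circle.coe_pow, hzn, Circle.coe_one]

end Literature.Computability.QuantumComplexity.BoykinEtAl
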